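import Summits.HodgeConjecture.Ring2.CaseGQuarticFieldClosed
import Summits.HodgeConjecture.CorCM.CMProductSimpleFactors
import Literature.AlgebraicGeometry.HodgeTheory.UnitaryTwoOneTimesCMCurveSquareCodimTwo
import HarnessLib

/-!
# Ring 2 (cell topic `Summits/HodgeConjecture/Ring2/`; seat `lit`, gen 66, R41): Moonen–Zarhin 1999 Thm. 0.2 (1), case (e) ∩ (a1), IS CLOSED in codimension two — the fivefold fact `MoonenZarhin1999_codimTwoHodgeClasses_abelianFivefold` is EQUIVALENT to its instances at the SIMPLE NON-CM fivefolds (Tankeev–Ribet shape) and FOLLOWS from Tankeev–Ribet; every non-simple or CM fivefold satisfies it unconditionally; `HCUpToDim 5` modulo Markman and Tankeev–Ribet is `HC(simple non-CM fourfolds outside Ribet (3,1) and quaternion type)`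

HONEST FRAMING (cell `pub-hodge-ring2`, verbatim): research route conditional on HC_CM; not a corollary;
Q11.4-sentence-2 already refuted in dim ≥ 3. `HC_CM` does NOT occur in this file. Markman's theorem
(`Markman2025_weilClasses_algebraic_abelianFourfold`) and Tankeev–Ribet
(`TankeevRibet1983_hodgeClasses_divisorial_powers_simplePrimeDimension`) are HYPOTHESES of the axis theorems, never
asserted. Theorems only — no definition, no named fact, no `sorry`. The NEW unconditional row recorded here is a
theorem of the Literature lane (`UnitaryTwoOneTimesCMCurveSquareCodimTwo`, Moonen–Zarhin's printed case (e) with (a1)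
in codimension two: `B²(T × E × E) ⊆ D² + α₁^* B²(T × E) + α₂^* B²(T × E)`, Lie step
`Motives/HodgeThetaAnnihilatorUnitaryTimesAbelianCommutant`); this file threads it into the cell's residual statements.

THE PRINT. B. Moonen, Yu. Zarhin, Math. Ann. **315** (1999), Thm. 0.2: «Let `X` be a complex abelian variety with
`dim(X) ≤ 5`. … (e) The abelian variety `X` is isogenous to a product `X₁² × X₂`, where `X₁` and `X₂` are as in (a)
… (1) Suppose we are in case (e). … Then the Hodge ring `B•(X)` is generated by the subalgebra `D•(X)` of divisor
classes together with the subspaces `W_{k,α}`»; with (2.8): «`B²(X) = D²(X) + Σ_α α^* B²(X')`»; §5 (5.11).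

THIS FILE.
* §1 **`moonenZarhin1999_codimTwoHodgeClasses_abelianFivefold_iff_simple_not_isOfCMType`** — the named fact is
  EQUIVALENT to its instances at the SIMPLE fivefolds NOT of CM type (the Tankeev–Ribet shape: «`B = D` for simple
  abelian varieties of prime dimension»); **`…_of_tankeevRibet`**: GRANTED Tankeev–Ribet (hypothesis), the named fact
  HOLDS — every other clause of the cell's census ((e) ∩ (a1) here; (f), (g) with `End⁰ = k` and with a quartic field,
  the CM fivefolds, the generic rows before) is a theorem of the tree.
* §2 **`isCodimTwoDivisorPullbackGenerated_of_dim_eq_five_of_isSimple_imp_isOfCMType`** — POINTWISE and UNCONDITIONAL: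
  every complex abelian fivefold that is non-simple or of CM type satisfies `B² ⊆ D² + Σ_α α^* B²(X')`.
* §3 **`hcUpToDim_five_iff_rowFour_of_markman_of_tankeevRibet`** — granted Markman and Tankeev–Ribet, `HCUpToDim 5` is
  EQUIVALENT to the Hodge conjecture on the single residual class of SIMPLE FOURFOLDS not of CM type, neither of Ribet
  type `(3,1)` over `k = End⁰` nor of minimal quaternion type [the rest of Moonen–Zarhin 1995]: the case-(e) ∩ (a1)
  cell satisfies HC granted Markman alone (`hcOnClass_caseE_of_markman`: HC for `T × E` is case (a), then the
  Literature lane's `hodgeConjectureFor_of_isIsogenous_cmCurve_cmCurve_simpleThreefold_of_hodgeConjectureFor`);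
  `hodgeConjectureFor_of_dim_eq_five_of_not_isSimple_of_markman'`: HC for every non-simple fivefold without simple
  fourfold isogeny factor, granted Markman alone.

WHAT IS NOT CLAIMED: Tankeev–Ribet (simple non-CM fivefolds) and the row-four residual (Moonen–Zarhin 1995) are NOT
closed; Markman is never asserted; the identification of the two pull-backs with Weil classes `W_{k,α}` and the
codimension-`3` part of Thm. 0.2 (1) are not formalised (not needed for the census, (2.8)).

## References
* [MoonenZarhin1999LowDim] B. Moonen, Yu. Zarhin, Math. Ann. 315 (1999) 711–733, Thm. 0.1, Thm. 0.2 (1)–(4), cases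
  (a), (e), (f), (g), (2.8), §2 (2.3), Thm. (2.7), §3 Lemma (3.4), Prop. (3.8), §5 (5.1), (5.3), (5.10)–(5.12).
* [Tankeev1983] S. G. Tankeev, *Cycles on simple abelian varieties of prime dimension*, Math. USSR-Izv. 20 (1983).
* [Ribet1983] K. A. Ribet, Amer. J. Math. 105 (1983), Thm. 3.
* [MumfordAV1970] D. Mumford, *Abelian Varieties* (1970), §19 Thm. 1, Cor. 2, §21 (pp. 201–202).
* [Deligne2000] P. Deligne, *The Hodge conjecture* (Clay problem description, 2000), §1.
* [vanGeemen1994HodgeAV] B. van Geemen, LNM 1594 (1994), §3.6 (p. 236), Lemma 3.7.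
* [claim: Markman2025SurveySecant, status: under-review] E. Markman, arXiv:2509.23403, Thm. 1.2.
-/

noncomputable section

open CategoryTheory CategoryTheory.Limits

namespace Summit.HodgeConjecture.Ring2.CaseEA1

open Literature.AlgebraicGeometry.Motives (AbelianVariety)
open Literature.AlgebraicGeometry.Motives.AbelianVariety
open Literature.AlgebraicGeometry.HodgeTheory
open Literature.AlgebraicGeometry.ComplexMultiplication
open Literature.AlgebraicGeometry.Milne1999
open NumberField
open Literature.NumberTheory.Automorphic (IsQuaternionAlgebra)
open Summit.HodgeConjecture.HodgeConjecture.Ring2.ClassTargets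
open Summit.HodgeConjecture.CorCM.Domination
open Summit.HodgeConjecture.Ring2.NonSimpleFivefoldsCodimTwo
open Summit.HodgeConjecture.Ring2.CMFivefoldsCodimTwo
open Summit.HodgeConjecture.Ring2.NonCMFivefoldsCodimTwoResidual (finrank_endAlgebra_eq_two_of_caseE)
open Summit.HodgeConjecture.Ring2.NonCMFivefoldsCodimTwoResidualQuartic (not_quaternionCell)
open Summit.HodgeConjecture.Ring2.LowDimOfMarkman
open Summit.HodgeConjecture.Ring2.CaseGQuarticField

variable {X : AbelianVariety ℂ}

/-! ### §1 The fivefold fact: equivalent to its simple non-CM instances; a consequence of Tankeev–Ribet -/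

/-- **LOCALISATION OF THE NAMED FACT, FINAL FORM.** `MoonenZarhin1999_codimTwoHodgeClasses_abelianFivefold`
(Thm. 0.2 in codimension `2` for ALL complex abelian fivefolds) is EQUIVALENT to its instances at the SIMPLE
fivefolds NOT of CM type — the clause of Tankeev–Ribet's theorem («`B = D` for simple abelian varieties of prime
dimension»). The residual «(e) ∩ (a1)» of `CaseGQuarticField.…_iff_residual_caseE` is DISCHARGED by the Literature
lane's `isCodimTwoDivisorPullbackGenerated_of_caseE_a1` (Thm. 0.2 (1) in codimension two, a theorem).
[cite: MoonenZarhin1999LowDim, Thm. 0.2 (1)–(4), (2.8), §2 Thm. (2.7) and §5 (5.1), (5.11)] [cite: Tankeev1983, main theorem] -/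
theorem moonenZarhin1999_codimTwoHodgeClasses_abelianFivefold_iff_simple_not_isOfCMType :
    MoonenZarhin1999_codimTwoHodgeClasses_abelianFivefold ↔
      ∀ A : AbelianVariety ℂ, A.dim = 5 → A.IsSimple → ¬ IsOfCMType A → IsCodimTwoDivisorPullbackGenerated A := by
  rw [moonenZarhin1999_codimTwoHodgeClasses_abelianFivefold_iff_residual_caseE]
  exact ⟨fun h => h.1, fun h => ⟨h, isCodimTwoDivisorPullbackGenerated_of_caseE_a1⟩⟩

/-- **THE FIVEFOLD FACT FOLLOWS FROM TANKEEV–RIBET** (HYPOTHESIS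
`TankeevRibet1983_hodgeClasses_divisorial_powers_simplePrimeDimension`, the tree's named fact for simple abelian
varieties of prime dimension — NOT discharged here): granted it, `B²(X) ⊆ D²(X) + Σ_α α^* B²(X')` for EVERY complex
abelian fivefold `X`, i.e. the tree's named fact `MoonenZarhin1999_codimTwoHodgeClasses_abelianFivefold` holds.
[cite: MoonenZarhin1999LowDim, Thm. 0.2 and §2 Thm. (2.7)] [cite: Tankeev1983, main theorem] [cite: Ribet1983, Thm. 3] -/
theorem moonenZarhin1999_codimTwoHodgeClasses_abelianFivefold_of_tankeevRibet
    (hTR : TankeevRibet1983_hodgeClasses_divisorial_powers_simplePrimeDimension) :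
    MoonenZarhin1999_codimTwoHodgeClasses_abelianFivefold :=
  (moonenZarhin1999_codimTwoHodgeClasses_abelianFivefold_iff_caseE_of_tankeevRibet hTR).2
    isCodimTwoDivisorPullbackGenerated_of_caseE_a1

/-! ### §2 Pointwise: every non-simple or CM fivefold, unconditionally -/

/-- **MOONEN–ZARHIN Thm. 0.2 IN CODIMENSION TWO FOR A SIMPLE FOURFOLD TIMES AN ELLIPTIC CURVE — ALL CASES, UNCONDITIONAL**
(`F` simple, `dim F = 4`, `dim C = 1`, `F × C` not of CM type): `End⁰(C) = ℚ` — Lemma (3.4); `C` of CM type and every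
central `φ` balanced — Prop. (3.8); unbalanced central `φ` («case (g)»): `End⁰(F) = k` — Thm. 0.2 (3) (R29);
`End⁰(F)` a quartic field — Thm. 0.2 (3) (R40, `hodgeConjectureFor_of_caseG_quarticField`); `dim_ℚ End⁰(F) = 8` —
empty (`not_quaternionCell`). [cite: MoonenZarhin1999LowDim, Thm. 0.2 (3)–(4), §3 Lemma (3.4), Prop. (3.8), §5 (5.10)]
[cite: MumfordAV1970, §21 (pp. 201–202)] -/
theorem isCodimTwoDivisorPullbackGenerated_simpleFourfold_prod_curve_of_not_isOfCMType {F C : AbelianVariety ℂ}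
    (hFs : F.IsSimple) (hF4 : F.dim = 4) (hC : C.dim = 1) (hcm : ¬ IsOfCMType (F.prod C)) :
    IsCodimTwoDivisorPullbackGenerated (F.prod C) := by
  by_cases hCcm : IsOfCMType C
  · obtain ⟨χ, d', hd', hχ⟩ := exists_hom_comp_self_eq_neg_of_cmCurve hC hCcm
    by_cases hbal : ∀ (φ : F ⟶ F) (M : ℕ), 0 < M → φ ≫ φ = -((M * M * d') • 𝟙 F) →
        AbelianVariety.endAlgebra.of F φ ∈ Subalgebra.center ℚ F.endAlgebra →
        eigenMultiplicity F φ (Complex.I * (Real.sqrt (M * M * d' : ℕ) : ℂ)) =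
          eigenMultiplicity F φ (-(Complex.I * (Real.sqrt (M * M * d' : ℕ) : ℂ)))
    · exact isCodimTwoDivisorPullbackGenerated_simpleFourfold_prod_cmCurve_of_balanced hFs hF4 hC χ hd' hχ hbal
    · simp only [not_forall, exists_prop] at hbal
      obtain ⟨φ, M, hM, hφ, hφZ, hne⟩ := hbal
      have hdM : 0 < M * M * d' := Nat.mul_pos (Nat.mul_pos hM hM) hd'
      have hF : ¬ IsOfCMType F := not_isOfCMType_of_caseG hcm hC hd' hχ (AbelianVariety.IsIsogenous.refl _)
      by_cases h2 : Module.finrank ℚ F.endAlgebra = 2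
      · exact isCodimTwoDivisorPullbackGenerated_fourfold_prod_cmCurve_of_unitaryTypeOne hF4 h2 φ hdM hφ
          (eigenMultiplicity_eq_one_or_eq_one_of_isSimple_of_dim_eq_four hFs hF4 φ hdM hφ hne) hC χ hd' hχ
      · rcases isField_or_finrank_eq_eight_of_dim_eq_four_of_not_isOfCMType_of_hom hFs hF4 hF φ hdM hφ hφZ h2 with
          ⟨hK, hK4⟩ | ⟨h8, hZ2⟩
        · exact (hodgeConjectureFor_of_caseG_quarticField hFs hF4 hK hK4 φ hdM hφ hne hC χ hd' hχ
            (AbelianVariety.IsIsogenous.refl _)).1.isCodimTwoDivisorPullbackGenerated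
        · exact (not_quaternionCell hFs hF4 h8 hZ2 hM hd' hφ hφZ hne).elim
  · exact isCodimTwoDivisorPullbackGenerated_fourfold_prod_curve_of_finrank_eq_one hF4 hC
      (finrank_endAlgebra_eq_one_of_curve_of_not_isOfCMType hC hCcm)
      (forall_hom_eq_zero_of_isSimple_of_dim_lt hFs (by omega))

/-- **MOONEN–ZARHIN Thm. 0.2 IN CODIMENSION TWO FOR EVERY COMPLEX ABELIAN FIVEFOLD THAT IS NON-SIMPLE OR OF CM TYPE —
POINTWISE, UNCONDITIONAL: `B²(X) ⊆ D²(X) + Σ_α α^* B²(X')`.** CM type: the cell's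
`isCodimTwoDivisorPullbackGenerated_of_isOfCMType`. Non-simple, not CM: case (e) — `X ∼ E × E × T`, `E` a CM elliptic
curve, `T` a simple threefold with `End⁰(E) ↪ End⁰(T)`, necessarily `dim_ℚ End⁰(T) = 2` ((5.3),
`finrank_endAlgebra_eq_two_of_caseE`) — is the Literature lane's NEW THEOREM
`isCodimTwoDivisorPullbackGenerated_of_isIsogenous_cmCurve_cmCurve_simpleThreefold` (Thm. 0.2 (1)); a simple fourfold
isogeny factor — `X ∼ F × C`, previous theorem; otherwise Thm. 0.2 (2), (4) (the cell's
`isCodimTwoDivisorPullbackGenerated_of_dim_eq_five_of_not_isSimple`). Only the SIMPLE fivefolds NOT of CM type remain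
(Tankeev–Ribet). [cite: MoonenZarhin1999LowDim, Thm. 0.2 (1)–(4) and §5 (5.1)–(5.12)] [cite: MumfordAV1970, §19 Thm. 1 (pp. 173–174)] -/
theorem isCodimTwoDivisorPullbackGenerated_of_dim_eq_five_of_isSimple_imp_isOfCMType (hX5 : X.dim = 5)
    (h : X.IsSimple → IsOfCMType X) : IsCodimTwoDivisorPullbackGenerated X := by
  by_cases hcm : IsOfCMType X
  · exact isCodimTwoDivisorPullbackGenerated_of_isOfCMType hX5 hcm
  have hs : ¬ X.IsSimple := fun hs => hcm (h hs)
  -- case (e)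
  by_cases hcaseE : ∃ E T : AbelianVariety ℂ, E.dim = 1 ∧ IsOfCMType E ∧ T.IsSimple ∧ T.dim = 3 ∧
      Nonempty (E.endAlgebra →+* T.endAlgebra) ∧ AbelianVariety.IsIsogenous X (E.prod (E.prod T))
  · obtain ⟨E, T, hE1, hEcm, hTs, hT3, ⟨j⟩, hXE⟩ := hcaseE
    exact isCodimTwoDivisorPullbackGenerated_of_isIsogenous_cmCurve_cmCurve_simpleThreefold hXE hE1 hEcm hTs hT3
      (finrank_endAlgebra_eq_two_of_caseE hE1 hEcm hTs hT3 (not_isOfCMType_of_caseE hcm hEcm hXE) j)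
  -- a simple fourfold isogeny factor
  by_cases h4 : ∃ F : AbelianVariety ℂ, F.IsSimple ∧ F.dim = 4 ∧ AVDominatedBy F X
  · obtain ⟨F, hFs, hF4, hFX⟩ := h4
    obtain ⟨C, hdim, hFC⟩ := exists_prod_isIsogenous_of_avDominatedBy hFX
    have hC : C.dim = 1 := by omega
    have hcm' : ¬ IsOfCMType (F.prod C) := fun h' => hcm ((isOfCMType_iff_of_isIsogenous hFC.symm').2 h')
    exact (isCodimTwoDivisorPullbackGenerated_simpleFourfold_prod_curve_of_not_isOfCMType hFs hF4 hC hcm').of_isIsogenous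
      hFC.symm'
  -- no simple fourfold factor, not case (e): Thm. 0.2 (2), (4)
  refine isCodimTwoDivisorPullbackGenerated_of_dim_eq_five_of_not_isSimple hX5 hs ?_ hcaseE
  intro F C hFs hF4 _ hXFC _ _ _ _ _ _ _ _ _ _
  obtain ⟨g, hg⟩ := hXFC
  exact absurd ⟨F, hFs, hF4, (Summit.HodgeConjecture.CorCM.SliceExhaustion.avDominatedBy_prod_left F C).trans_isIsogeny_inv hg⟩ h4

/-- The same, spelled with the disjunction. [cite: MoonenZarhin1999LowDim, Thm. 0.2] -/
theorem isCodimTwoDivisorPullbackGenerated_of_dim_eq_five_of_not_isSimple_or_isOfCMType (hX5 : X.dim = 5)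
    (h : ¬ X.IsSimple ∨ IsOfCMType X) : IsCodimTwoDivisorPullbackGenerated X :=
  isCodimTwoDivisorPullbackGenerated_of_dim_eq_five_of_isSimple_imp_isOfCMType hX5 fun hs => h.resolve_left fun h' => h' hs

/-! ### §3 The HC axis: case (e) ∩ (a1) granted Markman; `HCUpToDim 5` modulo Markman and Tankeev–Ribet is the row-four residual -/

/-- **HC ON THE CASE-(e) ∩ (a1) CELL, GRANTED MARKMAN'S THEOREM ALONE**: for `X ∼ E × E × T` (`E` a CM elliptic
curve, `T` a simple threefold with `dim_ℚ End⁰(T) = 2` and `End⁰(E) ↪ End⁰(T)`), HC for the fourfold `T × E` is case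
(a) (the cell's `hodgeConjectureFor_of_isIsogenous_caseA_of_markman`: Weil classes of fourfolds), and HC for `X`
follows by the Literature lane's `hodgeConjectureFor_of_isIsogenous_cmCurve_cmCurve_simpleThreefold_of_hodgeConjectureFor`
(codimension `2`: `D² + α₁^* B²(T × E) + α₂^* B²(T × E)`; hard Lefschetz for the rest) — «the Hodge conjecture for `X`
… follows from that for the abelian fourfolds». [cite: MoonenZarhin1999LowDim, Thm. 0.2 (1) with case (e) and §5 (5.11)]
[claim: Markman2025SurveySecant, status: under-review] -/
theorem hcOnClass_caseE_of_markman (hMark : Markman2025_weilClasses_algebraic_abelianFourfold) :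
    HCOnClass fun A => A.dim = 5 ∧
      (∃ E T : AbelianVariety ℂ, E.dim = 1 ∧ IsOfCMType E ∧ T.IsSimple ∧ T.dim = 3 ∧
        Module.finrank ℚ T.endAlgebra = 2 ∧ Nonempty (E.endAlgebra →+* T.endAlgebra) ∧
        AbelianVariety.IsIsogenous A (E.prod (E.prod T))) := by
  rintro A ⟨-, E, T, hE1, hEcm, hTs, hT3, hT2, hj, hAE⟩
  exact hodgeConjectureFor_of_isIsogenous_cmCurve_cmCurve_simpleThreefold_of_hodgeConjectureFor hAE hE1 hEcm hTs hT3
    hT2 (hodgeConjectureFor_of_isIsogenous_caseA_of_markman hMark (isIsogenous_prod_comm T E) hE1 hEcm hTs hT3 hj)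

/-- **HC FOR EVERY NON-SIMPLE FIVEFOLD WITHOUT SIMPLE FOURFOLD ISOGENY FACTOR, GRANTED MARKMAN ALONE** — the row
«case (e) ∩ (a1)» excluded by the cell's `hodgeConjectureFor_of_dim_eq_five_of_not_isSimple_of_markman` is now covered.
[cite: MoonenZarhin1999LowDim, Thm. 0.2 (1), (2), (4)] [claim: Markman2025SurveySecant, status: under-review] -/
theorem hodgeConjectureFor_of_dim_eq_five_of_not_isSimple_of_markman'
    (hMark : Markman2025_weilClasses_algebraic_abelianFourfold) (hX5 : X.dim = 5) (hX : ¬ X.IsSimple)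
    (h4 : ∀ F : AbelianVariety ℂ, F.IsSimple → F.dim = 4 → ¬ AVDominatedBy F X) :
    HodgeConjectureFor X.dim X.X := by
  by_cases hne : ∃ E T : AbelianVariety ℂ, E.dim = 1 ∧ IsOfCMType E ∧ T.IsSimple ∧ T.dim = 3 ∧
      Module.finrank ℚ T.endAlgebra = 2 ∧ Nonempty (E.endAlgebra →+* T.endAlgebra) ∧
      AbelianVariety.IsIsogenous X (E.prod (E.prod T))
  · exact hcOnClass_caseE_of_markman hMark X ⟨hX5, hne⟩
  · exact hodgeConjectureFor_of_dim_eq_five_of_not_isSimple_of_markman hMark hX5 hX h4 hne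

/-- **`HCUpToDim 5` MODULO MARKMAN AND TANKEEV–RIBET IS THE ROW-FOUR RESIDUAL.** Granted the tree's named facts
`Markman2025_weilClasses_algebraic_abelianFourfold` and `TankeevRibet1983_hodgeClasses_divisorial_powers_simplePrimeDimension`
(hypotheses), the Hodge conjecture for all complex abelian varieties of dimension `≤ 5` is EQUIVALENT to the Hodge
conjecture on the simple fourfolds not of CM type, neither of Ribet type `(3,1)` over `k = End⁰` nor of minimal
quaternion type [the rest of Moonen–Zarhin 1995] — every fivefold row of Thm. 0.2 is closed.
[cite: MoonenZarhin1999LowDim, Thm. 0.1, Thm. 0.2, §1 (1.1) and §2 Thm. (2.7)] [cite: Tankeev1983, main theorem]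
[claim: Markman2025SurveySecant, status: under-review] -/
theorem hcUpToDim_five_iff_rowFour_of_markman_of_tankeevRibet
    (hMark : Markman2025_weilClasses_algebraic_abelianFourfold)
    (hTR : TankeevRibet1983_hodgeClasses_divisorial_powers_simplePrimeDimension) :
    HCUpToDim 5 ↔ (HCOnClass fun A => A.dim = 4 ∧ A.IsSimple ∧ ¬ IsOfCMType A ∧
      (¬ ∃ (φ : A ⟶ A) (d : ℕ), 0 < d ∧ φ ≫ φ = -(d • 𝟙 A) ∧ Module.finrank ℚ A.endAlgebra = 2 ∧
        (eigenMultiplicity A φ (Complex.I * (Real.sqrt d : ℂ)) = 1 ∨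
          eigenMultiplicity A φ (-(Complex.I * (Real.sqrt d : ℂ))) = 1)) ∧
      (¬ ∃ (K : Type) (_ : Field K) (_ : NumberField K) (_ : IsTotallyReal K) (_ : Algebra K A.endAlgebra)
        (_ : IsScalarTower ℚ K A.endAlgebra) (_ : IsQuaternionAlgebra K A.endAlgebra), A.dim = 2 * Module.finrank ℚ K)) := by
  rw [hcUpToDim_five_iff_rowFour_caseE_of_markman_of_tankeevRibet hMark hTR]
  exact ⟨fun h => h.1, fun h => ⟨h, hcOnClass_caseE_of_markman hMark⟩⟩

/-- **On path**: the class of non-simple-or-CM fivefolds is a case of the summit. [cite: Deligne2000, §1] -/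
theorem nonSimpleOrCMFivefolds_hcOnClass_of_hodgeConjecture (h : _root_.HodgeConjecture) :
    HCOnClass fun A => A.dim = 5 ∧ (A.IsSimple → IsOfCMType A) :=
  hcOnClass_of_hodgeConjecture _ h

end Summit.HodgeConjecture.Ring2.CaseEA1

end
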